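import Summits.Ventures.GridStability.Models.StructurePreservingInvariant
import Literature.Analysis.ODE.LyapunovSublevelInvariance

/-!
# GridStability/Models/StructurePreservingPhase — the structure-preserving model as a first-order
# vector field on the phase space ℝⁿ × ℝⁿ and its first integrals

LADDER-GRIDFUSION rung G3 (model register) / G2 («structure-preserving lever»), seat
gridfusion-model-2; MODEL-VALIDITY row **MV-3**. Companion of `StructurePreserving.lean` (the model
in its printed second-order form `Mᵢ δ̈ᵢ + Dᵢ δ̇ᵢ + fᵢ(δ) = P⁰ᵢ` [cite: Padiyar2013, §3.2 eq (3.2)];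
[cite: BergenHill1981], with the Lyapunov computation dV/dt = −Σ Dᵢ δ̇ᵢ²), `…Energy`, `…Definite`,
`…Invariant` (sign, zero set, momentum first integral of the printed energy function (3.11)).

WHY THIS FILE. The tree's region-of-attraction theorems (`Literature/Analysis/ODE/
LyapunovSublevelInvariance`, `…/LyapunovBarbashinKrasovskii`) are stated for an autonomous equation
`X' = F(X)` on a normed space. The structure-preserving model mixes second-order equations
(generator internal nodes, `Mᵢ > 0`) with first-order ones (load buses, `Mᵢ = 0`: the Bergen–Hill
frequency-dependent load `Dᵢ δ̇ᵢ = P⁰ᵢ − fᵢ(δ)`), so its phase space is `(δ, ω_g)` — bus angles and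
GENERATOR frequency deviations [cite: Padiyar2013, §3.2 eqs (3.7)–(3.10): «M_g ω̇_g = …,
D_l ω_l = −T₂ᵀ[f(α) − P⁰]»]. We realise it on `(Fin n → ℝ) × (Fin n → ℝ) ∋ (δ, ω)` by carrying
the load-bus entries of `ω` as frozen coordinates (their component of the field is `0`; the set
`{ωᵢ = 0, i ∉ gen}` is an invariant constraint set), which keeps the phase space a fixed product
type. Everything here is PROVED; nothing is a certificate; MODELLED column only (model MV-3).

## Contents
* `vel`, `acc`, `phaseField` — the field `F(δ, ω) = (v, a)`: `vᵢ = ωᵢ` (gen) / `(P⁰ᵢ − fᵢ(δ))/Dᵢ`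
  (load), `aᵢ = (P⁰ᵢ − Dᵢ ωᵢ − fᵢ(δ))/Mᵢ` (gen) / `0` (load); `swing_phaseField`: the printed
  equation `Mᵢ aᵢ + Dᵢ vᵢ + fᵢ(δ) = P⁰ᵢ` holds identically; `phaseField_eq_zero_iff` (rest points =
  synchronous equilibria with zero generator frequencies); `contDiff_phaseField` (`F ∈ C^∞`);
* `toPhase`, `IsSolution.hasDerivAt_toPhase` — every printed-form solution `δ(t)` gives a global
  solution `t ↦ (δ(t), δ̇_g(t))` of `X' = F(X)` (the bridge to the a priori ODE theorems);
* `snd_apply_eq_of_solution` — load-bus frequency coordinates are first integrals;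
  `momentumCLM`, `momentum_eq_of_solution` — the momentum `L = Σ_gen Mᵢωᵢ + Σ Dᵢδᵢ` is a first
  integral of the SHIFTED field (`Σ P̄ᵢ = 0`, [cite: Padiyar2013, §3.2 eqs (3.3)–(3.5), (3.15)]).
The dissipation identity `⟨dV, F⟩ = −Σ Dᵢvᵢ²`, the uniqueness of the synchronous equilibrium in
the phase-cohesive window and the compactness of small energy sublevel sets are in
`StructurePreservingDissipation.lean`; the region-of-attraction ASSEMBLY (Barbashin–Krasovskii, a
sentence about solutions of MODEL MV-3) is the Lyapunov seat's file (cell custody), importing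
these.
-/

noncomputable section

open Finset Real Set

namespace Summit.Ventures.GridStability.Models.StructurePreserving.Params

variable {n : ℕ}

/-! ## The phase-space vector field -/

/-- Bus-angle velocity as a function of the phase point `x = (δ, ω)`: `vᵢ = ωᵢ` at a generator
internal node, `vᵢ = (P⁰ᵢ − fᵢ(δ))/Dᵢ` at a load bus (the first-order Bergen–Hill load equation
`Dᵢ δ̇ᵢ = P⁰ᵢ − fᵢ(δ)`, `Mᵢ = 0`) [cite: Padiyar2013, §3.2 eqs (3.2), (3.10)]. -/
def vel (p : Params n) (x : (Fin n → ℝ) × (Fin n → ℝ)) (i : Fin n) : ℝ :=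
  if i ∈ p.gen then x.2 i else (p.P0 i - p.pe x.1 i) / p.D i

/-- Acceleration component of the field: `aᵢ = (P⁰ᵢ − Dᵢ ωᵢ − fᵢ(δ))/Mᵢ` at a generator node
(the swing equation solved for `δ̈ᵢ`), `0` at a load bus (frozen spurious coordinate)
[cite: Padiyar2013, §3.2 eqs (3.2), (3.10)]. -/
def acc (p : Params n) (x : (Fin n → ℝ) × (Fin n → ℝ)) (i : Fin n) : ℝ :=
  if i ∈ p.gen then (p.P0 i - p.D i * x.2 i - p.pe x.1 i) / p.M i else 0

/-- The structure-preserving model as an autonomous vector field `F(δ, ω) = (v(δ, ω), a(δ, ω))` on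
the phase space `(Fin n → ℝ) × (Fin n → ℝ)` (MODEL MV-3; load-bus `ω`-coordinates frozen). -/
def phaseField (p : Params n) (x : (Fin n → ℝ) × (Fin n → ℝ)) : (Fin n → ℝ) × (Fin n → ℝ) :=
  (p.vel x, p.acc x)

/-- First component of the phase field = the velocity map. -/
@[simp] theorem phaseField_fst (p : Params n) (x : (Fin n → ℝ) × (Fin n → ℝ)) :
    (p.phaseField x).1 = p.vel x := rfl

/-- Second component of the phase field = the acceleration map. -/
@[simp] theorem phaseField_snd (p : Params n) (x : (Fin n → ℝ) × (Fin n → ℝ)) :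
    (p.phaseField x).2 = p.acc x := rfl

/-- Velocity at a generator node: `vᵢ = ωᵢ`. -/
theorem vel_of_mem {p : Params n} {i : Fin n} (hi : i ∈ p.gen) (x : (Fin n → ℝ) × (Fin n → ℝ)) :
    p.vel x i = x.2 i := if_pos hi

/-- Velocity at a load bus: `vᵢ = (P⁰ᵢ − fᵢ(δ))/Dᵢ` (first-order load equation). -/
theorem vel_of_not_mem {p : Params n} {i : Fin n} (hi : i ∉ p.gen)
    (x : (Fin n → ℝ) × (Fin n → ℝ)) : p.vel x i = (p.P0 i - p.pe x.1 i) / p.D i := if_neg hi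

/-- Acceleration at a generator node: the swing equation solved for `δ̈ᵢ`. -/
theorem acc_of_mem {p : Params n} {i : Fin n} (hi : i ∈ p.gen) (x : (Fin n → ℝ) × (Fin n → ℝ)) :
    p.acc x i = (p.P0 i - p.D i * x.2 i - p.pe x.1 i) / p.M i := if_pos hi

/-- Acceleration component at a load bus: `0` (frozen coordinate). -/
theorem acc_of_not_mem {p : Params n} {i : Fin n} (hi : i ∉ p.gen)
    (x : (Fin n → ℝ) × (Fin n → ℝ)) : p.acc x i = 0 := if_neg hi

/-- **The printed model equation holds identically for the phase field**: for well-formed data,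
`Mᵢ aᵢ(x) + Dᵢ vᵢ(x) + fᵢ(δ) = P⁰ᵢ` at every bus and every phase point
[cite: Padiyar2013, §3.2 eq (3.2)]. -/
theorem swing_phaseField {p : Params n} (hp : p.WellFormed) (x : (Fin n → ℝ) × (Fin n → ℝ))
    (i : Fin n) : p.M i * p.acc x i + p.D i * p.vel x i + p.pe x.1 i = p.P0 i := by
  by_cases hi : i ∈ p.gen
  · rw [acc_of_mem hi, vel_of_mem hi]
    have hM := (hp.M_pos i hi).ne'
    field_simp
    ring
  · rw [acc_of_not_mem hi, vel_of_not_mem hi, hp.M_eq_zero i hi]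
    have hD := (hp.D_pos i).ne'
    field_simp
    ring

/-- **Rest points of the phase field** (well-formed data): `F(δ, ω) = 0` iff `δ` is a synchronous
equilibrium of the data (`fᵢ(δ) = P⁰ᵢ` at every bus) and every generator frequency vanishes
[cite: Padiyar2013, §3.2 Remark 1]. (Load-bus `ω`-coordinates are unconstrained: they are
frozen.) -/
theorem phaseField_eq_zero_iff {p : Params n} (hp : p.WellFormed) (x : (Fin n → ℝ) × (Fin n → ℝ)) :
    p.phaseField x = 0 ↔ (∀ i, p.pe x.1 i = p.P0 i) ∧ ∀ i ∈ p.gen, x.2 i = 0 := by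
  constructor
  · intro h
    have hv : ∀ i, p.vel x i = 0 := fun i => by
      have := congrArg (fun y => y.1 i) h
      simpa using this
    have ha : ∀ i, p.acc x i = 0 := fun i => by
      have := congrArg (fun y => y.2 i) h
      simpa using this
    have hω : ∀ i ∈ p.gen, x.2 i = 0 := fun i hi => by rw [← vel_of_mem hi x]; exact hv i
    refine ⟨fun i => ?_, hω⟩
    have hsw := swing_phaseField hp x i
    rw [hv i, ha i] at hsw
    linarith
  · rintro ⟨hpe, hω⟩
    have hv : ∀ i, p.vel x i = 0 := fun i => by
      by_cases hi : i ∈ p.gen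
      · rw [vel_of_mem hi, hω i hi]
      · rw [vel_of_not_mem hi, hpe i, sub_self, zero_div]
    have ha : ∀ i, p.acc x i = 0 := fun i => by
      by_cases hi : i ∈ p.gen
      · rw [acc_of_mem hi, hω i hi, hpe i]; ring
      · rw [acc_of_not_mem hi]
    exact Prod.ext (funext hv) (funext ha)

/-- The injections are smooth functions of the bus angles. -/
theorem contDiff_pe (p : Params n) (i : Fin n) {m : WithTop ℕ∞} :
    ContDiff ℝ m fun δ : Fin n → ℝ => p.pe δ i := by
  unfold pe
  fun_prop

/-- The phase field is continuously differentiable (indeed smooth: trigonometric polynomials and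
linear maps), so the tree's existence / continuation theorems apply. -/
theorem contDiff_phaseField (p : Params n) {m : WithTop ℕ∞} : ContDiff ℝ m p.phaseField := by
  refine ContDiff.prodMk (contDiff_pi.2 fun i => ?_) (contDiff_pi.2 fun i => ?_)
  · by_cases hi : i ∈ p.gen
    · simp only [vel, if_pos hi]
      fun_prop
    · simp only [vel, if_neg hi]
      have h := (p.contDiff_pe i (m := m)).comp (contDiff_fst (E := Fin n → ℝ) (F := Fin n → ℝ))
      exact (contDiff_const.sub h).div_const _
  · by_cases hi : i ∈ p.gen
    · simp only [acc, if_pos hi]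
      have h := (p.contDiff_pe i (m := m)).comp (contDiff_fst (E := Fin n → ℝ) (F := Fin n → ℝ))
      have h2 : ContDiff ℝ m fun x : (Fin n → ℝ) × (Fin n → ℝ) => p.D i * x.2 i := by fun_prop
      exact ((contDiff_const.sub h2).sub h).div_const _
    · simp only [acc, if_neg hi]
      exact contDiff_const

/-! ## Printed-form solutions are phase-space solutions -/

/-- The phase curve of a bus-angle trajectory: `(δ(t), ω(t))` with `ωᵢ = δ̇ᵢ` at generator nodes
and `0` at load buses. -/
def toPhase (p : Params n) (δ : ℝ → Fin n → ℝ) (t : ℝ) : (Fin n → ℝ) × (Fin n → ℝ) :=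
  (δ t, fun i => if i ∈ p.gen then deriv (fun u => δ u i) t else 0)

/-- Angle component of the phase curve. -/
@[simp] theorem toPhase_fst (p : Params n) (δ : ℝ → Fin n → ℝ) (t : ℝ) : (p.toPhase δ t).1 = δ t :=
  rfl

/-- Frequency component of the phase curve at a generator node: `δ̇ᵢ`. -/
theorem toPhase_snd_of_mem {p : Params n} {i : Fin n} (hi : i ∈ p.gen) (δ : ℝ → Fin n → ℝ) (t : ℝ) :
    (p.toPhase δ t).2 i = deriv (fun u => δ u i) t := if_pos hi

/-- Frequency component of the phase curve at a load bus: `0`. -/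
theorem toPhase_snd_of_not_mem {p : Params n} {i : Fin n} (hi : i ∉ p.gen) (δ : ℝ → Fin n → ℝ)
    (t : ℝ) : (p.toPhase δ t).2 i = 0 := if_neg hi

/-- **Bridge**: every solution of the printed second-order model (`IsSolution`, well-formed data)
yields a solution of `X' = F(X)` on the phase space, for all times: the generator components by the
swing equation solved for `δ̈ᵢ`, the load-bus angles by the first-order load equation, the frozen
coordinates trivially [cite: Padiyar2013, §3.2 eqs (3.2), (3.10)]. -/
theorem IsSolution.hasDerivAt_toPhase {p : Params n} (hp : p.WellFormed) {δ : ℝ → Fin n → ℝ}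
    (h : p.IsSolution δ) (t : ℝ) :
    HasDerivAt (p.toPhase δ) (p.phaseField (p.toPhase δ t)) t := by
  have h1 : HasDerivAt (fun s => δ s) (p.vel (p.toPhase δ t)) t := by
    rw [hasDerivAt_pi]
    intro i
    have hd := ((h.differentiable i) t).hasDerivAt
    by_cases hi : i ∈ p.gen
    · rw [vel_of_mem hi, toPhase_snd_of_mem hi]
      exact hd
    · have hsw := h.swing t i
      rw [hp.M_eq_zero i hi, zero_mul, zero_add] at hsw
      have hval : deriv (fun s => δ s i) t = (p.P0 i - p.pe (δ t) i) / p.D i := by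
        rw [eq_div_iff (hp.D_pos i).ne']
        linarith
      rw [vel_of_not_mem hi, toPhase_fst, ← hval]
      exact hd
  have h2 : HasDerivAt (fun s => fun i => if i ∈ p.gen then deriv (fun u => δ u i) s else 0)
      (p.acc (p.toPhase δ t)) t := by
    rw [hasDerivAt_pi]
    intro i
    by_cases hi : i ∈ p.gen
    · have hdd := ((h.differentiable_deriv i hi) t).hasDerivAt
      have hsw := h.swing t i
      have hval : deriv (deriv fun s => δ s i) t
          = (p.P0 i - p.D i * deriv (fun s => δ s i) t - p.pe (δ t) i) / p.M i := by
        rw [eq_div_iff (hp.M_pos i hi).ne']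
        linarith
      rw [acc_of_mem hi, toPhase_fst, toPhase_snd_of_mem hi, ← hval]
      simp only [if_pos hi]
      exact hdd
    · rw [acc_of_not_mem hi]
      simp only [if_neg hi]
      exact hasDerivAt_const t (0 : ℝ)
  exact h1.prodMk h2

/-- The bridge in the tree's solution convention: a printed-form solution is a global solution of
`X' = F(X)` on every `[0, T]`. -/
theorem IsSolution.toPhase_solution {p : Params n} (hp : p.WellFormed) {δ : ℝ → Fin n → ℝ}
    (h : p.IsSolution δ) (T : ℝ) (t : ℝ) (_ht : t ∈ Icc 0 T) :
    HasDerivWithinAt (p.toPhase δ) (p.phaseField (p.toPhase δ t)) (Icc 0 T) t :=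
  (h.hasDerivAt_toPhase hp t).hasDerivWithinAt

/-! ## First integrals: frozen load coordinates and the momentum -/

/-- The `i`-th frequency coordinate as a continuous linear functional on the phase space. -/
def sndCoord (i : Fin n) : ((Fin n → ℝ) × (Fin n → ℝ)) →L[ℝ] ℝ :=
  (ContinuousLinearMap.proj i).comp (ContinuousLinearMap.snd ℝ (Fin n → ℝ) (Fin n → ℝ))

/-- The `i`-th angle coordinate as a continuous linear functional on the phase space. -/
def fstCoord (i : Fin n) : ((Fin n → ℝ) × (Fin n → ℝ)) →L[ℝ] ℝ :=
  (ContinuousLinearMap.proj i).comp (ContinuousLinearMap.fst ℝ (Fin n → ℝ) (Fin n → ℝ))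

/-- `sndCoord i` evaluates to the `i`-th frequency coordinate. -/
@[simp] theorem sndCoord_apply (i : Fin n) (x : (Fin n → ℝ) × (Fin n → ℝ)) :
    sndCoord i x = x.2 i := rfl

/-- `fstCoord i` evaluates to the `i`-th angle coordinate. -/
@[simp] theorem fstCoord_apply (i : Fin n) (x : (Fin n → ℝ) × (Fin n → ℝ)) :
    fstCoord i x = x.1 i := rfl

/-- **The load-bus frequency coordinates are first integrals** of the phase field (their component
of `F` is `0`): along every solution on `[0, T]`, `(X t).2 i = (X 0).2 i` for `i ∉ gen`. Hence the
constraint set `{ωᵢ = 0, i ∉ gen}` is invariant. -/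
theorem snd_apply_eq_of_solution (p : Params n) {i : Fin n} (hi : i ∉ p.gen)
    {X : ℝ → (Fin n → ℝ) × (Fin n → ℝ)} {T : ℝ}
    (hX : ∀ t ∈ Icc 0 T, HasDerivWithinAt X (p.phaseField (X t)) (Icc 0 T) t) {t : ℝ}
    (ht : t ∈ Icc 0 T) : (X t).2 i = (X 0).2 i := by
  have h := Literature.Analysis.ODE.apply_eq_of_fderiv_apply_eq_zero (F := p.phaseField)
    (h := fun x => x.2 i) (h' := fun _ => sndCoord i) (fun x => (sndCoord i).hasFDerivAt)
    (fun x => by simp [acc_of_not_mem hi]) hX ht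
  exact h

/-- The momentum functional `L(δ, ω) = Σ_{i ∈ gen} Mᵢ ωᵢ + Σᵢ Dᵢ δᵢ` of
`StructurePreservingInvariant` as a continuous linear functional on the phase space. -/
def momentumCLM (p : Params n) : ((Fin n → ℝ) × (Fin n → ℝ)) →L[ℝ] ℝ :=
  ∑ i ∈ p.gen, p.M i • sndCoord i + ∑ i, p.D i • fstCoord i

/-- `momentumCLM` evaluates to the momentum functional of `StructurePreservingInvariant`. -/
@[simp] theorem momentumCLM_apply (p : Params n) (x : (Fin n → ℝ) × (Fin n → ℝ)) :
    p.momentumCLM x = p.momentum x.1 x.2 := by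
  simp [momentumCLM, momentum]

/-- **Momentum balance for the phase field**: `L(F(x)) = Σᵢ P⁰ᵢ` at every phase point (losslessness
`Σᵢ fᵢ = 0` and the identity `Mᵢ aᵢ + Dᵢ vᵢ + fᵢ = P⁰ᵢ`) — the pointwise form of
[cite: Padiyar2013, §3.2 eq (3.15)]. -/
theorem momentumCLM_phaseField {p : Params n} (hp : p.WellFormed) (x : (Fin n → ℝ) × (Fin n → ℝ)) :
    p.momentumCLM (p.phaseField x) = ∑ i, p.P0 i := by
  rw [momentumCLM_apply, momentum, phaseField_fst, phaseField_snd]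
  have h1 : ∑ i ∈ p.gen, p.M i * p.acc x i = ∑ i, p.M i * p.acc x i := by
    apply Finset.sum_subset (Finset.subset_univ _)
    intro i _ hi
    rw [hp.M_eq_zero i hi, zero_mul]
  have h2 : ∀ i, p.M i * p.acc x i + p.D i * p.vel x i = p.P0 i - p.pe x.1 i := fun i => by
    have := swing_phaseField hp x i
    linarith
  rw [h1, ← Finset.sum_add_distrib, Finset.sum_congr rfl fun i _ => h2 i, Finset.sum_sub_distrib,
    p.sum_pe_eq_zero hp.b_symm, sub_zero]

/-- In the frequency-shifted frame (`P⁰ ↦ P̄`, `Σ P̄ᵢ = 0`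
[cite: Padiyar2013, §3.2 eqs (3.3)–(3.5)]) the momentum is a FIRST INTEGRAL of the phase field:
`L(F̄(x)) = 0`. -/
theorem momentumCLM_phaseField_shifted {p : Params n} (hp : p.WellFormed) (hD : ∑ i, p.D i ≠ 0)
    (x : (Fin n → ℝ) × (Fin n → ℝ)) : p.momentumCLM (p.shifted.phaseField x) = 0 := by
  have hp' : p.shifted.WellFormed := ⟨hp.M_pos, hp.M_eq_zero, hp.D_pos, hp.b_symm⟩
  have h := momentumCLM_phaseField hp' x
  have hL : p.shifted.momentumCLM = p.momentumCLM := rfl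
  rw [hL] at h
  rw [h]
  simpa only [shifted_P0] using p.sum_Pbar_eq_zero hD

/-- **Conservation of momentum along phase solutions of the shifted model**: on `[0, T]`,
`L(X t) = L(X 0)`; so every level set `{L = L₀}` is an invariant constraint set — the device that
pins the rotational symmetry without internodal coordinates (`StructurePreservingInvariant`). -/
theorem momentum_eq_of_solution {p : Params n} (hp : p.WellFormed) (hD : ∑ i, p.D i ≠ 0)
    {X : ℝ → (Fin n → ℝ) × (Fin n → ℝ)} {T : ℝ}
    (hX : ∀ t ∈ Icc 0 T, HasDerivWithinAt X (p.shifted.phaseField (X t)) (Icc 0 T) t) {t : ℝ}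
    (ht : t ∈ Icc 0 T) : p.momentum (X t).1 (X t).2 = p.momentum (X 0).1 (X 0).2 := by
  have h := Literature.Analysis.ODE.apply_eq_of_fderiv_apply_eq_zero (F := p.shifted.phaseField)
    (h := fun x => p.momentumCLM x) (h' := fun _ => p.momentumCLM)
    (fun x => p.momentumCLM.hasFDerivAt)
    (fun x => momentumCLM_phaseField_shifted hp hD x) hX ht
  simpa only [momentumCLM_apply] using h

end Summit.Ventures.GridStability.Models.StructurePreserving.Params

end
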